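import Summits.QuantumFields.YangMills.Theorems.FluctuationComparisonRegPrIntLS2BetaChartReadDescentDerivKStepSupT3
import Summits.QuantumFields.YangMills.Theorems.FluctuationComparisonRegPrIntLS2BetaQuaternionReadDictionary
import HarnessLib

/-!
# (D2) in the quaternion-read currency: the k-step sup bound for `DMq`

Organ `GAP♯∘` of crux `stmt-QuantumFields-20520` (`FluctuationComparisonRegPrIntL`), S2β lane, letter «MULT♭» = CRIT-m♮ ∧ MULT♮ ∧ AVG₂♭, road
MULT♮ ⟸ (RINV-curl) (✓`…S2BetaMultOfPreimages`, ✓`…S2BetaPreimagesOfFaceSpreads.exists_preimage_curl_of_faceSpreads`).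

The (RINV-curl) door is stated for an `ℝ³`-valued linear constraint map; on the T³ organ that map is the QUATERNION READ
`DMq := fderiv ℝ (ζ B ↦ imVec (su2Quat (descendTo … (expPoint ζ · U₀) B · (descendTo … U₀ B)⁻¹))) 0` of ✓`…S2BetaCritMQuaternionRead`, related to the Pauli-charted
`DM` by the dictionary ✓`…S2BetaQuaternionReadDictionary.coord_qfderiv_apply` (`⟨su2Coord (rev ((DMq ζ) B)), _⟩ = DΨ_{K−J}(0)(coord ζ)(σ B)`).

This file transports the (D2) k-step sup bound ✓`…ChartReadDescentDerivKStepSupT3.norm_fderiv_chartRead_descendTo_expPoint_apply_le` to `DMq` through the Pauli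
isometry `‖⟨su2Coord (rev x), _⟩‖ = ‖x‖` (✓`norm_coord_eq`):

`‖(DMq ζ) B‖ ≤ (1 + 4(d+2))·exp(c₃·Σ_{i<K−J} (5L)²∕4·θ(K−i))·L^{K−J}·‖ζ‖_∞`, `c₃ = (d+2)(422 + 1616(d+2))` (`d = 3`),

under the uniform guard of the dictionary (`(5L)²∕4·θ_h ≤ α ≤ 1∕24`, `α < δ_{SU(2)}`, `157α < L⁻²`, `U₀ ∈ histGood`). This is the `‖u_B w‖`-half of the door's
contraction hypothesis `hu` (the other half is the thin-loop bound on the interior defect `I_w`).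

References: T. Bałaban, *Averaging operations for lattice gauge theories*, CMP 98 (1985) 17–51, Prop. 3–4 pp. 36–37, (139)–(147) pp. 39–40 [Balaban1985Averaging];
*Ultraviolet stability of three-dimensional lattice pure gauge field theories*, CMP 102 (1985) 255–275, (7) p. 257, p. 260 [Balaban1985UV3];
*Renormalization group approach to lattice gauge field theories. I*, CMP 109 (1987) 249–301, (0.11) p. 253 [Balaban1987RG1].
-/

set_option autoImplicit false

open scoped BigOperators Matrix.Norms.L2Operator Topology
open Filter Set Function

namespace Summit.QuantumFields.YangMills.Theorems.FluctuationComparisonRegPrIntLS2BetaQuaternionReadDerivKStepSup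

open Literature.MathematicalPhysics.QuantumLattice (su2Quat)
open Literature.MathematicalPhysics.QuantumFieldTheory.Balaban1983to89
open Literature.MathematicalPhysics.QuantumFieldTheory.Balaban1983to89.HaarExponentialChart
open Literature.MathematicalPhysics.QuantumFieldTheory.Balaban1983to89.HaarExponentialChart.IsChartRep
open Literature.MathematicalPhysics.QuantumFieldTheory.Balaban1983to89.BlockAveraging (Idx loopHol blockAvg)
open Literature.MathematicalPhysics.QuantumFieldTheory.Balaban1983to89.ExpMeanLog (expMeanLogSU deltaSU)
open Literature.MathematicalPhysics.QuantumFieldTheory.Balaban1983to89.Node00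
open Literature.MathematicalPhysics.QuantumFieldTheory.Balaban1983to89.T3ContinuumYM3Torus
open Literature.MathematicalPhysics.QuantumFieldTheory.Balaban1983to89.T3UnitLawDensityEML (ℰp)
open Literature.MathematicalPhysics.QuantumFieldTheory.Balaban1983to89.T3UnitScaleTilt
open Literature.MathematicalPhysics.QuantumFieldTheory.Balaban1983to89.T3TiltDescent
open Literature.MathematicalPhysics.QuantumFieldTheory.Balaban1983to89.T3LevelShift (fieldShift bondShift)
open Literature.MathematicalPhysics.QuantumFieldTheory.Balaban1983to89.T4HaarSU2ExpChart (expPoint)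
open Literature.MathematicalPhysics.QuantumFieldTheory.Balaban1983to89.T4ExpWindowSmallField (imVec)
open Literature.MathematicalPhysics.QuantumFieldTheory.Balaban1983to89.B10Eq18SigmaSU2 (su2Coord)
open Literature.MathematicalPhysics.QuantumFieldTheory.Balaban1983to89.B10Eq18SigmaSU2Haar (rev)
open Summit.QuantumFields.YangMills.Theorems.FluctuationComparisonRegPrIntLS2BetaChartReadDescentOntoExpPoint (su2Coord_rev_mem_lie)
open Summit.QuantumFields.YangMills.Theorems.FluctuationComparisonRegPrIntLS2BetaChartReadDescentDerivFactorisation (fderiv_chartRead_descendTo_expPoint_apply)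
open Summit.QuantumFields.YangMills.Theorems.FluctuationComparisonRegPrIntLS2BetaChartReadDescentDerivKStepSupT3
  (norm_coord_eq norm_fderiv_chartRead_descendTo_expPoint_apply_le)
open Summit.QuantumFields.YangMills.Theorems.FluctuationComparisonRegPrIntLS2BetaQuaternionReadDictionary (coord_qfderiv_apply)

variable {F : T3Family}

/-- THE NORM DICTIONARY: `‖(DMq ζ) B‖ = ‖↑((DM ζ) B)‖` — the quaternion read and the Pauli-charted read of the linearised descent have the same bond-wise norms
(✓`coord_qfderiv_apply` + (E) ✓`fderiv_chartRead_descendTo_expPoint_apply` + the Pauli isometry ✓`norm_coord_eq`). [cite: Balaban1985UV3, p. 260; Balaban1985Averaging, (125) p.36] -/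
theorem norm_qfderiv_apply_eq {J K : ℕ} (hJK : J ≤ K) {θ : ℕ → ℝ} (hθ0 : ∀ i, 0 ≤ θ i) {α : ℝ}
    (hθα : ∀ i, J < i → i ≤ K → (((5 * F.L : ℕ) : ℝ) ^ 2 / 4) * θ i ≤ α)
    (hα24 : α ≤ 1 / 24) (hαδ : α < deltaSU (Fin 2)) (hαL : 157 * α < ((F.L : ℝ) ^ 2)⁻¹)
    {U₀ : GaugeField (F.P K) 0 (SU 2)} (hUg : U₀ ∈ histGood F ℰp θ K J)
    (ζ : PBond (F.P K) 0 → EuclideanSpace ℝ (Fin 3)) (B : PBond (F.P J) 0) :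
    ‖fderiv ℝ (fun (ζ : PBond (F.P K) 0 → EuclideanSpace ℝ (Fin 3)) (B : PBond (F.P J) 0) =>
        imVec (su2Quat (descendTo F ℰp J K hJK (fun ℓ => expPoint (ζ ℓ) * U₀ ℓ) B * (descendTo F ℰp J K hJK U₀ B)⁻¹))) 0 ζ B‖ =
      ‖((fderiv ℝ (fun (ζ : PBond (F.P K) 0 → EuclideanSpace ℝ (Fin 3)) (B : PBond (F.P J) 0) =>
          (isChartRep_specialUnitaryGroup (n := Fin 2)).logChart
            (descendTo F ℰp J K hJK (fun ℓ => expPoint (ζ ℓ) * U₀ ℓ) B * (descendTo F ℰp J K hJK U₀ B)⁻¹)) 0 ζ B :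
          (specialUnitaryLogChart (Fin 2)).lie) : Matrix (Fin 2) (Fin 2) ℂ)‖ := by
  have hθδ : ∀ h, J < h → h ≤ K → (((5 * F.L : ℕ) : ℝ) ^ 2 / 4) * θ h < deltaSU (Fin 2) :=
    fun h h1 h2 => (hθα h h1 h2).trans_lt hαδ
  rw [← norm_coord_eq (fderiv ℝ (fun (ζ : PBond (F.P K) 0 → EuclideanSpace ℝ (Fin 3)) (B : PBond (F.P J) 0) =>
        imVec (su2Quat (descendTo F ℰp J K hJK (fun ℓ => expPoint (ζ ℓ) * U₀ ℓ) B * (descendTo F ℰp J K hJK U₀ B)⁻¹))) 0 ζ B),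
    coord_qfderiv_apply (F := F) hJK hθ0 hθα hα24 hαδ hαL hUg ζ B, Submodule.coe_norm,
    fderiv_chartRead_descendTo_expPoint_apply (F := F) hJK hθ0 hθδ hUg ζ B]

/-- ★★★ **(D2) FOR `DMq`**: under the dictionary's uniform guard, `‖(DMq ζ) B‖ ≤ (1 + 4(d+2))·exp(c₃·Σ_{i<K−J} (5L)²∕4·θ(K−i))·L^{K−J}·‖ζ‖_∞` with
`c₃ = (d+2)(422 + 1616(d+2))` — the (D2) k-step sup bound ✓`norm_fderiv_chartRead_descendTo_expPoint_apply_le` read through ✓`norm_qfderiv_apply_eq`; the `DM`-half of the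
(RINV-curl) door's contraction hypothesis `‖u_B w‖ ≤ ½‖w‖` (✓`…PreimagesOfFaceSpreads.exists_preimage_curl_of_faceSpreads`, `u_B w = DMq(I_w)(B)`).
[cite: Balaban1985Averaging, Prop. 3-4 pp.36-37, (139)-(147) pp.39-40; Balaban1985UV3, (7) p.257, p.260; Balaban1987RG1, (0.11) p.253] -/
theorem norm_qfderiv_apply_le {J K : ℕ} (hJK : J ≤ K) {θ : ℕ → ℝ} (hθ0 : ∀ i, 0 ≤ θ i) {α : ℝ}
    (hθα : ∀ i, J < i → i ≤ K → (((5 * F.L : ℕ) : ℝ) ^ 2 / 4) * θ i ≤ α)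
    (hα24 : α ≤ 1 / 24) (hαδ : α < deltaSU (Fin 2)) (hαL : 157 * α < ((F.L : ℝ) ^ 2)⁻¹)
    {U₀ : GaugeField (F.P K) 0 (SU 2)} (hUg : U₀ ∈ histGood F ℰp θ K J)
    (ζ : PBond (F.P K) 0 → EuclideanSpace ℝ (Fin 3)) (B : PBond (F.P J) 0) :
    ‖fderiv ℝ (fun (ζ : PBond (F.P K) 0 → EuclideanSpace ℝ (Fin 3)) (B : PBond (F.P J) 0) =>
        imVec (su2Quat (descendTo F ℰp J K hJK (fun ℓ => expPoint (ζ ℓ) * U₀ ℓ) B * (descendTo F ℰp J K hJK U₀ B)⁻¹))) 0 ζ B‖ ≤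
      (1 + 4 * (((F.P K).d + 2 : ℕ) : ℝ)) *
          Real.exp ((((F.P K).d + 2 : ℕ) : ℝ) * (422 + 1616 * (((F.P K).d + 2 : ℕ) : ℝ)) *
            ∑ i ∈ Finset.range (K - J), (((5 * F.L : ℕ) : ℝ) ^ 2 / 4) * θ (K - i)) *
        ((F.P K).L : ℝ) ^ (K - J) * ‖ζ‖ := by
  have hθ24 : ∀ h, J < h → h ≤ K → (((5 * F.L : ℕ) : ℝ) ^ 2 / 4) * θ h ≤ 1 / 24 :=
    fun h h1 h2 => (hθα h h1 h2).trans hα24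
  have hθδ : ∀ h, J < h → h ≤ K → (((5 * F.L : ℕ) : ℝ) ^ 2 / 4) * θ h < deltaSU (Fin 2) :=
    fun h h1 h2 => (hθα h h1 h2).trans_lt hαδ
  rw [norm_qfderiv_apply_eq (F := F) hJK hθ0 hθα hα24 hαδ hαL hUg ζ B]
  exact norm_fderiv_chartRead_descendTo_expPoint_apply_le (F := F) hJK hθ0 hθ24 hθδ hUg ζ B

/-- ★ **(D2) FOR `DMq`, UNIFORM-GUARD FORM**: with the single constant `α` of the dictionary, `‖(DMq ζ) B‖ ≤ (1 + 4(d+2))·exp(c₃·(K−J)·α)·L^{K−J}·‖ζ‖_∞` (each summand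
`(5L)²∕4·θ(K−i) ≤ α`). [cite: Balaban1985Averaging, (139)-(147) pp.39-40; Balaban1985UV3, (7) p.257] -/
theorem norm_qfderiv_apply_le_uniform {J K : ℕ} (hJK : J ≤ K) {θ : ℕ → ℝ} (hθ0 : ∀ i, 0 ≤ θ i) {α : ℝ}
    (hθα : ∀ i, J < i → i ≤ K → (((5 * F.L : ℕ) : ℝ) ^ 2 / 4) * θ i ≤ α)
    (hα24 : α ≤ 1 / 24) (hαδ : α < deltaSU (Fin 2)) (hαL : 157 * α < ((F.L : ℝ) ^ 2)⁻¹)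
    {U₀ : GaugeField (F.P K) 0 (SU 2)} (hUg : U₀ ∈ histGood F ℰp θ K J)
    (ζ : PBond (F.P K) 0 → EuclideanSpace ℝ (Fin 3)) (B : PBond (F.P J) 0) :
    ‖fderiv ℝ (fun (ζ : PBond (F.P K) 0 → EuclideanSpace ℝ (Fin 3)) (B : PBond (F.P J) 0) =>
        imVec (su2Quat (descendTo F ℰp J K hJK (fun ℓ => expPoint (ζ ℓ) * U₀ ℓ) B * (descendTo F ℰp J K hJK U₀ B)⁻¹))) 0 ζ B‖ ≤
      (1 + 4 * (((F.P K).d + 2 : ℕ) : ℝ)) *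
          Real.exp ((((F.P K).d + 2 : ℕ) : ℝ) * (422 + 1616 * (((F.P K).d + 2 : ℕ) : ℝ)) * ((K - J : ℕ) * α)) *
        ((F.P K).L : ℝ) ^ (K - J) * ‖ζ‖ := by
  refine (norm_qfderiv_apply_le (F := F) hJK hθ0 hθα hα24 hαδ hαL hUg ζ B).trans ?_
  have hsum : ∑ i ∈ Finset.range (K - J), (((5 * F.L : ℕ) : ℝ) ^ 2 / 4) * θ (K - i) ≤ ((K - J : ℕ) : ℝ) * α := by
    calc ∑ i ∈ Finset.range (K - J), (((5 * F.L : ℕ) : ℝ) ^ 2 / 4) * θ (K - i)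
        ≤ ∑ _i ∈ Finset.range (K - J), α := Finset.sum_le_sum fun i hi => hθα (K - i) (by
            have := Finset.mem_range.1 hi; omega) (by omega)
      _ = ((K - J : ℕ) : ℝ) * α := by rw [Finset.sum_const, Finset.card_range, nsmul_eq_mul]
  have hc : 0 ≤ (((F.P K).d + 2 : ℕ) : ℝ) * (422 + 1616 * (((F.P K).d + 2 : ℕ) : ℝ)) := by positivity
  gcongr

end Summit.QuantumFields.YangMills.Theorems.FluctuationComparisonRegPrIntLS2BetaQuaternionReadDerivKStepSup
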